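import Summits.CriticalPhenomena.PercolationContinuityZ3.Theorems.PercNearOneGluingAdditiveGluingBlockMultiEdge
import HarnessLib

/-! # Crux `PercNearOneGluing.AdditiveGluing` (stmt-CriticalPhenomena-4576) — splitting the contact set of a glued block: the
# two-expansion certificate of the finger multi-edge Lemma 3 (seat (b) V⁺-form, depth prover `png-dp-vplus`)

Support file (`--supports stmt-CriticalPhenomena-4576`); no definitions, no named facts.  Companion of `…AdditiveGluingBlockMultiEdge.lean`.

`g` glues the block `N`; `F = F₁ ∪ F₂` two sets of contact pairs `s(v,a)` (`v ∈ N`, `a ∉ N`) — e.g. the contacts of two vertices of the block,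
or of two fingers glued together; `R`, `R₁`, `R₂` = "some pair of `F` / `F₁` / `F₂` is open"; `U = ⋃_{s∈N}{s ↔ b}`;
`g ⊖ F₁ := pinW g F₁ ∅` (the contacts of `F₁` killed); `Δ_p(F', E) := μ_p(R' ∩ E)` etc.

* `contact_split` (exact identity): `μ_g(R ∩ E) = μ_g(R₁ ∩ E) + μ_g(no pair of F₁ open) · μ_{g⊖F₁}(R₂ ∩ E)` for every event `E` — split `R`
  according to whether a pair of `F₁` is open, and condition on "all of `F₁` closed" (`prodBernoulli_real_inter_localCylinder`).
  Hence `concl_g(F) = [μ_g(R₁∩d↔b) − μ_g(R₁∩U)] + μ_g([F₁ closed])·concl_{g⊖F₁}(F₂)` — the EXPANSION OVER `F₁`.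
* `block_multiEdge_twoLevel` (**the `A₁` case, hypothesis-free**): if (1) `μ_{g⊖F₁}(d↔b) ≤ μ_{g⊖F₁}(a↔b)` for every `F₁`-relay `a`, and
  (2) some `F₁`-relay `a⋆` satisfies `μ_{g⊖F}(a⋆↔b) ≤ μ_{g⊖F}(a↔b)` for every `F₂`-relay `a`, then `μ_g(R ∩ {d↔b}) ≤ μ_g(R ∩ U)`.  Proof: `block_multiEdge_of_witness` on `F₁` with witness `d` itself, `contact_split`, and `block_multiEdge_singleWitness` on
  `F₂` in the weighting `g⊖F₁` with witness `a⋆` (its hypothesis `μ_{g⊖F₁}(d↔b) ≤ μ_{g⊖F₁}(a⋆↔b)` is an instance of (1)).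
* `block_multiEdge_of_split` (**the `¬A₁` form**): if `μ_g(d↔b) ≤ μ_g(c↔b)` for some `c` that is `(g⊖F₂)`-below every `F₂`-relay, and the
  contact set `F₁` alone satisfies the conclusion in the weighting `g⊖F₂` (`μ_{g⊖F₂}(R₁∩d↔b) ≤ μ_{g⊖F₂}(R₁∩U)`), then
  `μ_g(R ∩ {d↔b}) ≤ μ_g(R ∩ U)`.
For two independent fingers `x₁, x₂` glued into one block (`F_i` = contacts of `x_i`) these are the two halves of the depth-prover's
TWO-EXPANSION CERTIFICATE for the registered open stub `stub_fingerML3_vp` (seat NOTES / HANDOFF on the item): with the fingers labelled so that the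
globally weakest contact relay `a⋆` (in `g⊖F`) is a neighbour of `x₁`, the stub's conclusion follows from `block_multiEdge_twoLevel` whenever `d` is
`(g⊖F₁)`-minimal over `x₁`'s relays (≈ 88 % of the exact instances examined), and otherwise from `block_multiEdge_of_split` modulo the two
inequalities of conjecture CONJ-NB (0 counterexamples in the examined instances).  Nothing here uses the stub's unglued hypothesis.
[cite: KozmaNitzan2024, Lemma 3(i) (pp. 6–7), Lemma 5 (p. 13), §3.2 pp. 12–14]
-/

namespace Summit.CriticalPhenomena.PercolationContinuityZ3.Theorems

open MeasureTheory Set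
open Literature.Probability.LatticeModels (prodBernoulli)
open Literature.Probability.Percolation (BondConfig openConn openGraph openEdgeCluster pinW localCylinder
  DeterminedBy determinedBy_iff)

noncomputable section
open Classical

section BlockMultiEdgeSplit

open Literature.Probability.LatticeModels Literature.Probability.Percolation

variable {n : ℕ}

/-- "No pair of `F₁` is open" is the cylinder `[∅]_{F₁}`. [folklore] -/
theorem notSomeOpen_eq_localCylinder (F₁ : Finset (Sym2 (Fin n))) :
    ({ω : Set (Sym2 (Fin n)) | ∃ e ∈ F₁, e ∈ ω}ᶜ : Set (BondConfig (Fin n))) =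
      localCylinder (↑F₁ : Set (Sym2 (Fin n))) (∅ : Set (Sym2 (Fin n))) := by
  ext ω
  simp only [Set.mem_compl_iff, Set.mem_setOf_eq, not_exists, not_and, localCylinder, Finset.mem_coe,
    Set.mem_empty_iff_false, iff_false]

/-- **Splitting the contact set** (exact identity).  `F = F₁ ∪ F₂`; `R`, `R₁`, `R₂` = some pair of `F`, `F₁`, `F₂` open.  For every event `E`:
`μ_g(R ∩ E) = μ_g(R₁ ∩ E) + μ_g(no pair of F₁ open) · μ_{pinW g F₁ ∅}(R₂ ∩ E)` — on `R ∖ R₁` some pair of `F₂` is open and all of `F₁` is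
closed, and conditioning on "all of `F₁` closed" is the killed weighting. [folklore; KozmaNitzan2024 §4 p. 20 (conditioning on patterns)] -/
theorem contact_split (g : Sym2 (Fin n) → unitInterval) (F₁ F₂ : Finset (Sym2 (Fin n))) (E : Set (BondConfig (Fin n))) :
    (prodBernoulli g).real ({ω : Set (Sym2 (Fin n)) | ∃ e ∈ F₁ ∪ F₂, e ∈ ω} ∩ E) =
      (prodBernoulli g).real ({ω : Set (Sym2 (Fin n)) | ∃ e ∈ F₁, e ∈ ω} ∩ E) +
        (prodBernoulli g).real ({ω : Set (Sym2 (Fin n)) | ∃ e ∈ F₁, e ∈ ω}ᶜ : Set (BondConfig (Fin n))) *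
          (prodBernoulli (pinW g (↑F₁ : Set (Sym2 (Fin n))) (∅ : Set (Sym2 (Fin n))))).real
            ({ω : Set (Sym2 (Fin n)) | ∃ e ∈ F₂, e ∈ ω} ∩ E) := by
  set R : Set (BondConfig (Fin n)) := {ω : Set (Sym2 (Fin n)) | ∃ e ∈ F₁ ∪ F₂, e ∈ ω} with hR
  set R₁ : Set (BondConfig (Fin n)) := {ω : Set (Sym2 (Fin n)) | ∃ e ∈ F₁, e ∈ ω} with hR₁
  set R₂ : Set (BondConfig (Fin n)) := {ω : Set (Sym2 (Fin n)) | ∃ e ∈ F₂, e ∈ ω} with hR₂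
  have hmeas : ∀ s : Set (BondConfig (Fin n)), MeasurableSet s := fun _ => MeasurableSet.of_discrete
  have hsplit := measureReal_inter_add_sdiff (μ := prodBernoulli g) (s := R ∩ E) (hmeas R₁)
  have h1 : (R ∩ E) ∩ R₁ = R₁ ∩ E := by
    ext ω
    simp only [Set.mem_inter_iff, hR, hR₁, Set.mem_setOf_eq, Finset.mem_union]
    constructor
    · rintro ⟨⟨-, hE⟩, h1⟩; exact ⟨h1, hE⟩
    · rintro ⟨⟨e, he, heω⟩, hE⟩; exact ⟨⟨⟨e, Or.inl he, heω⟩, hE⟩, ⟨e, he, heω⟩⟩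
  have h2 : (R ∩ E) \ R₁ = (R₂ ∩ E) ∩ R₁ᶜ := by
    ext ω
    simp only [Set.mem_sdiff, Set.mem_inter_iff, Set.mem_compl_iff, hR, hR₁, hR₂, Set.mem_setOf_eq, Finset.mem_union]
    constructor
    · rintro ⟨⟨⟨e, he, heω⟩, hE⟩, hno⟩
      rcases he with he | he
      · exact (hno ⟨e, he, heω⟩).elim
      · exact ⟨⟨⟨e, he, heω⟩, hE⟩, hno⟩
    · rintro ⟨⟨⟨e, he, heω⟩, hE⟩, hno⟩; exact ⟨⟨⟨e, Or.inr he, heω⟩, hE⟩, hno⟩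
  rw [h1, h2] at hsplit
  rw [← hsplit, notSomeOpen_eq_localCylinder F₁,
    prodBernoulli_real_inter_localCylinder g F₁ (∅ : Set (Sym2 (Fin n))) (hmeas (R₂ ∩ E))]

/-- Killing `F₁` and then `F₂` is killing `F₁ ∪ F₂`. [folklore] -/
theorem pinW_empty_pinW_empty (g : Sym2 (Fin n) → unitInterval) (F₁ F₂ : Finset (Sym2 (Fin n))) :
    pinW (pinW g (↑F₁ : Set (Sym2 (Fin n))) (∅ : Set (Sym2 (Fin n)))) (↑F₂ : Set (Sym2 (Fin n))) ↑(∅ : Finset (Sym2 (Fin n))) =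
      pinW g (↑(F₁ ∪ F₂) : Set (Sym2 (Fin n))) (∅ : Set (Sym2 (Fin n))) := by
  rw [Finset.coe_empty, pinW_pinW_same, Finset.coe_union]

/-- **Case `A₁` of the two-expansion certificate (hypothesis-free in the unglued weighting).**  `g` glues `N`; `F₁`, `F₂` contact sets;
(1) `d` is `(pinW g F₁ ∅)`-below every `F₁`-relay; (2) `a⋆` is an endpoint relay of a pair of `F₁` and is `(pinW g (F₁ ∪ F₂) ∅)`-below every
`F₂`-relay.  Then `μ_g(R ∩ {d↔b}) ≤ μ_g(R ∩ ⋃_{s∈N}{s↔b})`, `R` = some pair of `F₁ ∪ F₂` open.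
Proof: expansion over `F₁` (`contact_split`); the `F₁`-part by `block_multiEdge_of_witness` with witness `d`; the killed part is the block
multi-edge Lemma 3 for `F₂` in `pinW g F₁ ∅` with the single witness `a⋆`, whose glued hypothesis `μ(d↔b) ≤ μ(a⋆↔b)` there is an instance
of (1). [cite: KozmaNitzan2024, Lemma 3(i) (pp. 6–7), Lemma 5 (p. 13)] -/
theorem block_multiEdge_twoLevel (g : Sym2 (Fin n) → unitInterval) (N : Finset (Fin n)) (F₁ F₂ : Finset (Sym2 (Fin n)))
    (hF₁ : ∀ e ∈ F₁, ∃ v ∈ N, ∃ a ∉ N, e = s(v, a)) (hF₂ : ∀ e ∈ F₂, ∃ v ∈ N, ∃ a ∉ N, e = s(v, a))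
    (hglue : ∀ u ∈ N, ∀ u' ∈ N, u ≠ u' → g s(u, u') = 1)
    (d astar b : Fin n) {v₀ : Fin n} (hv₀ : v₀ ∈ N) (hastarN : astar ∉ N) (hastar : s(v₀, astar) ∈ F₁)
    (h1 : ∀ v ∈ N, ∀ a ∉ N, s(v, a) ∈ F₁ →
      (prodBernoulli (pinW g (↑F₁ : Set (Sym2 (Fin n))) ↑(∅ : Finset (Sym2 (Fin n))))).real (openConn d b) ≤
        (prodBernoulli (pinW g (↑F₁ : Set (Sym2 (Fin n))) ↑(∅ : Finset (Sym2 (Fin n))))).real (openConn a b))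
    (h2 : ∀ v ∈ N, ∀ a ∉ N, s(v, a) ∈ F₂ →
      (prodBernoulli (pinW g (↑(F₁ ∪ F₂) : Set (Sym2 (Fin n))) (∅ : Set (Sym2 (Fin n))))).real (openConn astar b) ≤
        (prodBernoulli (pinW g (↑(F₁ ∪ F₂) : Set (Sym2 (Fin n))) (∅ : Set (Sym2 (Fin n))))).real (openConn a b)) :
    (prodBernoulli g).real ({ω : Set (Sym2 (Fin n)) | ∃ e ∈ F₁ ∪ F₂, e ∈ ω} ∩ openConn d b) ≤
      (prodBernoulli g).real ({ω : Set (Sym2 (Fin n)) | ∃ e ∈ F₁ ∪ F₂, e ∈ ω} ∩ ⋃ s ∈ N, openConn s b) := by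
  set g₁ : Sym2 (Fin n) → unitInterval := pinW g (↑F₁ : Set (Sym2 (Fin n))) (∅ : Set (Sym2 (Fin n))) with hg₁
  have hcoe : (↑(∅ : Finset (Sym2 (Fin n))) : Set (Sym2 (Fin n))) = ∅ := Finset.coe_empty
  -- (a) the `F₁`-part: witness `d` itself
  have hA : (prodBernoulli g).real ({ω : Set (Sym2 (Fin n)) | ∃ e ∈ F₁, e ∈ ω} ∩ openConn d b) ≤
      (prodBernoulli g).real ({ω : Set (Sym2 (Fin n)) | ∃ e ∈ F₁, e ∈ ω} ∩ ⋃ s ∈ N, openConn s b) :=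
    block_multiEdge_of_witness g N F₁ hF₁ hglue d d b h1 le_rfl le_rfl
  -- (b) the killed part: `F₂` in `g₁`, witness `a⋆`
  have hglue₁ : ∀ u ∈ N, ∀ u' ∈ N, u ≠ u' → g₁ s(u, u') = 1 := by
    intro u hu u' hu' huu'
    have hnot : s(u, u') ∉ (↑F₁ : Set (Sym2 (Fin n))) := by
      intro he
      obtain ⟨v, -, a, haN, he'⟩ := hF₁ _ (Finset.mem_coe.1 he)
      have : a ∈ s(u, u') := by rw [he']; exact Sym2.mem_mk_right v a
      rcases Sym2.mem_iff.1 this with rfl | rfl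
      · exact haN hu
      · exact haN hu'
    rw [hg₁, pinW_apply_of_not_mem g _ hnot]
    exact hglue u hu u' hu' huu'
  have hstar₁ : ∀ v ∈ N, ∀ a ∉ N, s(v, a) ∈ F₂ →
      (prodBernoulli (pinW g₁ (↑F₂ : Set (Sym2 (Fin n))) ↑(∅ : Finset (Sym2 (Fin n))))).real (openConn astar b) ≤
        (prodBernoulli (pinW g₁ (↑F₂ : Set (Sym2 (Fin n))) ↑(∅ : Finset (Sym2 (Fin n))))).real (openConn a b) := by
    intro v hv a haN he
    rw [hg₁, pinW_empty_pinW_empty g F₁ F₂]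
    exact h2 v hv a haN he
  have hle₁ : (prodBernoulli g₁).real (openConn d b) ≤ (prodBernoulli g₁).real (openConn astar b) := by
    have := h1 v₀ hv₀ astar hastarN hastar
    rwa [hcoe] at this
  have hB := block_multiEdge_singleWitness g₁ N F₂ hF₂ hglue₁ d astar b hstar₁ hle₁
  -- assemble with the split identity
  rw [contact_split g F₁ F₂ (openConn d b), contact_split g F₁ F₂ (⋃ s ∈ N, openConn s b)]
  have hC0 : 0 ≤ (prodBernoulli g).real ({ω : Set (Sym2 (Fin n)) | ∃ e ∈ F₁, e ∈ ω}ᶜ : Set (BondConfig (Fin n))) :=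
    measureReal_nonneg
  have hBm := mul_le_mul_of_nonneg_left hB hC0
  linarith

/-- **The `¬A₁` form of the two-expansion certificate.**  `g` glues `N`; `F₁`, `F₂` contact sets.  If (i) `μ_g(d↔b) ≤ μ_g(c↔b)` for a
vertex `c` that is `(pinW g F₂ ∅)`-below every `F₂`-relay, and (ii) the contact set `F₁` alone satisfies the multi-edge conclusion in the
weighting with `F₂` killed, `μ_{g⊖F₂}(R₁ ∩ {d↔b}) ≤ μ_{g⊖F₂}(R₁ ∩ U)`, then `μ_g(R ∩ {d↔b}) ≤ μ_g(R ∩ U)` for `R` = some pair of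
`F₁ ∪ F₂` open.  (Expansion over `F₂`: `contact_split` with the roles exchanged, `block_multiEdge_singleWitness` on `F₂`.)
[cite: KozmaNitzan2024, Lemma 3(i) (pp. 6–7), Lemma 5 (p. 13)] -/
theorem block_multiEdge_of_split (g : Sym2 (Fin n) → unitInterval) (N : Finset (Fin n)) (F₁ F₂ : Finset (Sym2 (Fin n)))
    (hF₂ : ∀ e ∈ F₂, ∃ v ∈ N, ∃ a ∉ N, e = s(v, a))
    (hglue : ∀ u ∈ N, ∀ u' ∈ N, u ≠ u' → g s(u, u') = 1)
    (d c b : Fin n)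
    (hc : ∀ v ∈ N, ∀ a ∉ N, s(v, a) ∈ F₂ →
      (prodBernoulli (pinW g (↑F₂ : Set (Sym2 (Fin n))) ↑(∅ : Finset (Sym2 (Fin n))))).real (openConn c b) ≤
        (prodBernoulli (pinW g (↑F₂ : Set (Sym2 (Fin n))) ↑(∅ : Finset (Sym2 (Fin n))))).real (openConn a b))
    (hi : (prodBernoulli g).real (openConn d b) ≤ (prodBernoulli g).real (openConn c b))
    (hii : (prodBernoulli (pinW g (↑F₂ : Set (Sym2 (Fin n))) (∅ : Set (Sym2 (Fin n))))).real
        ({ω : Set (Sym2 (Fin n)) | ∃ e ∈ F₁, e ∈ ω} ∩ openConn d b) ≤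
      (prodBernoulli (pinW g (↑F₂ : Set (Sym2 (Fin n))) (∅ : Set (Sym2 (Fin n))))).real
        ({ω : Set (Sym2 (Fin n)) | ∃ e ∈ F₁, e ∈ ω} ∩ ⋃ s ∈ N, openConn s b)) :
    (prodBernoulli g).real ({ω : Set (Sym2 (Fin n)) | ∃ e ∈ F₁ ∪ F₂, e ∈ ω} ∩ openConn d b) ≤
      (prodBernoulli g).real ({ω : Set (Sym2 (Fin n)) | ∃ e ∈ F₁ ∪ F₂, e ∈ ω} ∩ ⋃ s ∈ N, openConn s b) := by
  have hB := block_multiEdge_singleWitness g N F₂ hF₂ hglue d c b hc hi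
  rw [Finset.union_comm F₁ F₂, contact_split g F₂ F₁ (openConn d b), contact_split g F₂ F₁ (⋃ s ∈ N, openConn s b)]
  have hC0 : 0 ≤ (prodBernoulli g).real ({ω : Set (Sym2 (Fin n)) | ∃ e ∈ F₂, e ∈ ω}ᶜ : Set (BondConfig (Fin n))) :=
    measureReal_nonneg
  have hm := mul_le_mul_of_nonneg_left hii hC0
  linarith

/-- Registered rung `stub_blockMultiEdgeTwoLevel_vp` of crux stmt-CriticalPhenomena-4576 (depth prover png-dp-vplus, seat (b) V⁺-form): case `A₁`
of the two-expansion certificate — `block_multiEdge_twoLevel`, closed statement. [cite: KozmaNitzan2024, Lemma 3(i) (pp. 6–7), Lemma 5 (p. 13)] -/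
theorem stub_blockMultiEdgeTwoLevel_vp : ∀ (n : ℕ) (g : Sym2 (Fin n) → unitInterval) (N : Finset (Fin n)) (F₁ F₂ : Finset (Sym2 (Fin n))) (d astar b v₀ : Fin n), (∀ e ∈ F₁, ∃ v ∈ N, ∃ a ∉ N, e = s(v, a)) → (∀ e ∈ F₂, ∃ v ∈ N, ∃ a ∉ N, e = s(v, a)) → (∀ u ∈ N, ∀ u' ∈ N, u ≠ u' → g s(u, u') = 1) → v₀ ∈ N → astar ∉ N → s(v₀, astar) ∈ F₁ → (∀ v ∈ N, ∀ a ∉ N, s(v, a) ∈ F₁ → (Literature.Probability.LatticeModels.prodBernoulli (Literature.Probability.Percolation.pinW g (↑F₁ : Set (Sym2 (Fin n))) ↑(∅ : Finset (Sym2 (Fin n))))).real (Literature.Probability.Percolation.openConn d b) ≤ (Literature.Probability.LatticeModels.prodBernoulli (Literature.Probability.Percolation.pinW g (↑F₁ : Set (Sym2 (Fin n))) ↑(∅ : Finset (Sym2 (Fin n))))).real (Literature.Probability.Percolation.openConn a b)) → (∀ v ∈ N, ∀ a ∉ N, s(v, a) ∈ F₂ → (Literature.Probability.LatticeModels.prodBernoulli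 (Literature.Probability.Percolation.pinW g (↑(F₁ ∪ F₂) : Set (Sym2 (Fin n))) (∅ : Set (Sym2 (Fin n))))).real (Literature.Probability.Percolation.openConn astar b) ≤ (Literature.Probability.LatticeModels.prodBernoulli (Literature.Probability.Percolation.pinW g (↑(F₁ ∪ F₂) : Set (Sym2 (Fin n))) (∅ : Set (Sym2 (Fin n))))).real (Literature.Probability.Percolation.openConn a b)) → (Literature.Probability.LatticeModels.prodBernoulli g).real ({ω : Set (Sym2 (Fin n)) | ∃ e ∈ F₁ ∪ F₂, e ∈ ω} ∩ Literature.Probability.Percolation.openConn d b) ≤ (Literature.Probability.LatticeModels.prodBernoulli g).real ({ω : Set (Sym2 (Fin n)) | ∃ e ∈ F₁ ∪ F₂, e ∈ ω} ∩ ⋃ s ∈ N, Literature.Probability.Percolation.openConn s b) :=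
  fun _ g N F₁ F₂ d astar b _ hF₁ hF₂ hglue hv₀ hastarN hastar h1 h2 =>
    block_multiEdge_twoLevel g N F₁ F₂ hF₁ hF₂ hglue d astar b hv₀ hastarN hastar h1 h2

end BlockMultiEdgeSplit

end

end Summit.CriticalPhenomena.PercolationContinuityZ3.Theorems
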